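import Summits.BirchSwinnertonDyer.BirchSwinnertonDyer.Theorems.ByReductionTypeAtTwoFineSelmerConjAAtTwoAdditivePotGoodAscentStampsA
import HarnessLib

/-!
# C4″ `AdditivePotMultOverKAtTwo` (item stmt-BirchSwinnertonDyer-22618), the (I1M′) input of the upper half on the `Δ < 0` rows:
# KERNEL STAMPS, part G — Iwasawa's `μ₂ = 0` (ZERO hypotheses) for the `2`-torsion cubic fields `d = -867`, `d = -948` and UNCONDITIONAL
# statement (A) at `2` for the C4″ census curves 152592cf1, 379200cd1

Cell `bsd-2adic`, rung K4, seat `bsd-2adic-k4-w3` GEN 11 (explicit unit of director-bsd g16 (309)(7); `--supports stmt-BirchSwinnertonDyer-22618`).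
HONEST FRAMING (D-0036/D-0054/D-0152): THEOREMS ONLY (no definition, no named fact, no `sorry`). FIELD PART (unconditional kernel arithmetic about an
explicit cubic field `ℚ(θ)`; generator = eng-2's polredabs cubic when its index `[𝓞 : ℤ[θ]]` is odd, else an odd-index second generator):
`irreducible_cubic_<d>`, `odd_classNumber_of_root_<d>` (norm certificate below the Minkowski bound; k4-w1's `odd_classNumber_of_cubeCertificate`),
**`classicalMu_two_cubicField_<d>`** = `μ = 0` (growth form) along EVERY cyclotomic `ℤ₂`-extension of `ℚ(θ)` from `e₀ = 0` (odd `h`), `e₁ = 0` (k4-w1's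
Chevalley door at `2`, `layerOneBit_of_chevalleyCert`: a unit with `2`-adic image `≡ ±3 (mod 8)` is not a norm from `ℚ(θ, √2)`; ≤ 2 primes above `2`),
`n₀ = 0` (odd cubic discriminant `…_of_odd_cubic_discr`, or `2 = 𝔭𝔮²` with an even-index certificate `…_of_evenIndexCertificate`) and Fukuda 1994 Thm. 1 (1)
(`_holds`). These fields have TWO primes above `2` (the `2`-division cubic of a potentially multiplicative curve has a `ℚ₂`-root). ROW PART:
`conjA_two_<L>'` = Coates–Sujatha's statement (A) at `p = 2` for the census cubic model of the Cremona class (a-invariants of addL2x GEN 13's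
`nst_census-j313647.tsv`), PROVED OUTRIGHT: field identification `ℚ(β) = ℚ(θ)` + cruxlead-19573-w2's door
`TotallyComplexMu.conjA_two_cubicModel_of_classicalMu_of_discr_neg` (kernel Lim 3.5@2 + `ℓ = 2` ascent). Certificates (norm witnesses, fundamental units by a
relation sieve, Hensel data, even-index elements) found by the seat's exact-arithmetic tools (`work/tools/`) and CHECKED HERE by the kernel; eng-2's
census CERT-ADD-POTMULT-FUKUDA269-E2 agrees (`μ₂ = λ₂ = 0`, bnfcertify). Statement (A) is NOT BSD: BSD₂ for these curves is not proved; C4″ / (I1M′) stay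
research-open; nothing booked; no row of 22618 changes tier (pen RC-490 (4)). Pattern/toolkit: k4-w1 GEN 5–8 (`…MuTwoKernelRows{A,B}`, `…AscentStampsA`).

References: [CoatesSujatha2005] Conj. A, Thm. 3.4; [Iwasawa1973MuInvariants] Thm. 2/3; [Fukuda1994] Thm. 1 (1); [Lang1990] Ch. 13 §4 Lemma 4.1;
[Washington1997] §13.1; [Marcus1977] Ch. 5 Thm. 35–37; [Cohen1993] §6.3; [Lim2017FineSelmer] §3; cell files `eng2/fukuda269/{TABLE,LAYERS}-…-E2-v1.tsv`.
-/

set_option autoImplicit false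
-- sibling precedent (`…MuTwoKernelRowsA.lean`): the directory name repeats the summit name
set_option linter.dupNamespace false

noncomputable section
open scoped Classical IntermediateField NumberField Real nonZeroDivisors
namespace Summit.BirchSwinnertonDyer.BirchSwinnertonDyer.Theorems.AddKatoTwo
open WeierstrassCurve Field Polynomial IsDedekindDomain NumberField Matrix Literature.NumberTheory.EllipticCurves
  Literature.NumberTheory.GaloisRepresentations
  Literature.NumberTheory.IwasawaTheory
  Summit.BirchSwinnertonDyer.BirchSwinnertonDyer.Theorems.SteinbergFibreAtTwo
  Summit.BirchSwinnertonDyer.BirchSwinnertonDyer.Theorems.AlignedTransportAtTwoTorsionPointField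
  Summit.BirchSwinnertonDyer.BirchSwinnertonDyer.Theses.ByReductionTypeAtTwo

/-! ## The cubic field of discriminant `-867` (`X³ + (-1)X² + (-11)X + (-12)`, index `1`; C4″ rows 152592cf1) -/

/-- `X³ + (-1)X² + (-11)X + (-12)` is irreducible over `ℚ` (no root mod `7`). -/
theorem irreducible_cubic_d867n : Irreducible (Cubic.toPoly ⟨1, ((-1 : ℤ) : ℚ), ((-11 : ℤ) : ℚ), ((-12 : ℤ) : ℚ)⟩) :=
  haveI : Fact (Nat.Prime 7) := ⟨by norm_num⟩
  irreducible_cubic_of_no_root_zmod 7 (by decide)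

section Certd867n

variable (K : Type) [Field K] [NumberField K]

/-- **`h` is ODD for every cubic number field whose integers contain a root `θ` of `X³ + (-1)X² + (-11)X + (-12)`** (`|disc| = 867` = `|d_K|`,
`M_K < 9`): a norm certificate — for every prime `ℓ < 9` and every root `a` of the cubic mod `ℓ` a generator `x + yθ + zθ² ∈ ℤ[θ]` of norm `±ℓ`
of the ideal `I ∋ ℓ, θ − a` (coordinates `(x, y, z)`: `ℓ = 2`: `a = 0` ↦ `(-2, -1, 0)`; `ℓ = 3`: `a = 0` ↦ `(-9, -10, -3)`, `a = 2` ↦ `(-1, -1, 0)`; `ℓ = 5`: `a = 2` ↦ `(-1, -4, 1)`; `ℓ = 7`: no root); found by the seat's relation sieve and CHECKED HERE by the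
kernel (`pow_three_eq_span_of_cert`, `Or.inl`). eng-2's PARI value (bnfcertify): `h = 1`. KERNEL. [cite: Marcus1977, Ch. 5 Thm. 35–37 and Cor. 2] [cite: Cohen1993, §6.3] -/
theorem odd_classNumber_of_root_d867n (h3 : Module.finrank ℚ K = 3) (b : 𝓞 K)
    (hb : b ^ 3 + (-1 : ℤ) * b ^ 2 + (-11 : ℤ) * b + (-12 : ℤ) = 0) : Odd (NumberField.classNumber K) := by
  have hirr := irreducible_cubic_d867n
  have hd : |NumberField.discr K| ≤ (867 : ℕ) :=
    (abs_discr_le_abs_cubic_discr K h3 b hirr hb).trans (by simp only [Cubic.discr]; norm_num)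
  refine odd_classNumber_of_cubeCertificate K h3 (B := 9)
    (minkowskiBound_lt_of_sqrt_le K h3 hd (s := 29.45)
      ((Real.sqrt_le_sqrt (by norm_num : ((867 : ℕ) : ℝ) ≤ (29.45 : ℝ) ^ 2)).trans (Real.sqrt_sq (by norm_num)).le)
      (by norm_num)) ?_
  intro ℓ hℓB hℓ J hJ
  interval_cases ℓ <;> norm_num at hℓ
  · -- `ℓ = 2`: roots [0]
    refine pow_three_eq_span_of_cert K h3 b hirr hb (by norm_num) (fun a ha hdvd => ?_) hJ
    interval_cases a <;> norm_num at hdvd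
    · exact Or.inl ⟨(-2), (-1), (0), 1, by norm_num, by norm_num, ⟨_, by rw [Nat.cast_one, one_mul]⟩, by norm_num⟩
  · -- `ℓ = 3`: roots [0, 2]
    refine pow_three_eq_span_of_cert K h3 b hirr hb (by norm_num) (fun a ha hdvd => ?_) hJ
    interval_cases a <;> norm_num at hdvd
    · exact Or.inl ⟨(-9), (-10), (-3), 1, by norm_num, by norm_num, ⟨_, by rw [Nat.cast_one, one_mul]⟩, by norm_num⟩
    · exact Or.inl ⟨(-1), (-1), (0), 1, by norm_num, by norm_num, ⟨_, by rw [Nat.cast_one, one_mul]⟩, by norm_num⟩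
  · -- `ℓ = 5`: roots [2]
    refine pow_three_eq_span_of_cert K h3 b hirr hb (by norm_num) (fun a ha hdvd => ?_) hJ
    interval_cases a <;> norm_num at hdvd
    · exact Or.inl ⟨(-1), (-4), (1), 1, by norm_num, by norm_num, ⟨_, by rw [Nat.cast_one, one_mul]⟩, by norm_num⟩
  · -- `ℓ = 7`: roots []
    refine pow_three_eq_span_of_cert K h3 b hirr hb (by norm_num) (fun a ha hdvd => ?_) hJ
    interval_cases a <;> norm_num at hdvd

end Certd867n

/-- **Iwasawa's `μ₂ = 0` for the cubic field of discriminant `-867`** (`ℚ(θ)`, `θ³ + (-1)θ² + (-11)θ + (-12) = 0`; TWO primes above `2`,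
`2` unramified (odd discriminant); `h` odd), KERNEL — every cyclotomic `ℤ₂`-extension of `ℚ(θ)` has `μ = 0` (growth form; indeed `e_n = 0` for all `n`).
Chevalley's door at `2` (k4-w1 `layerOneBit_of_chevalleyCert`): the unit `ε = (-79) + (-91)θ + (-28)θ²` (regulator ≈ 6.88;
`ε³ + (972)ε² + (54)ε + (1) = 0`) has `ε ≡ 5 (mod 8)` under `θ ↦ z₂ ≡ 4` (`8 ∣ g(4)`, `g'(4)` odd), so `(ε, 2)_𝔭 = −1`: a non-norm
from `ℚ(θ, √2)`, whence `e₁ = 0`; `≤ 2` primes above `2` by `4 ∤ g(2)`, `4 ∤ g(1)`; `e₀ = 0` by `odd_classNumber_of_root_d867n`; `n₀ = 0` because the discriminant is odd (`classicalMuVanishes_two_adjoin_of_odd_cubic_discr`); Fukuda 1994 Thm. 1 (1) (`_holds`).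
The (I1M′) input of GEN 9's door for the C4″ rows 152592cf1. [cite: Fukuda1994, Thm. 1 (1), p. 264] [cite: Lang1990, Ch. 13 §4, Lemma 4.1]
[cite: Washington1997, §13.1] [cite: Greenberg2001IwasawaPastPresent, §4 (Iwasawa's μ-conjecture)] -/
theorem classicalMu_two_cubicField_d867n {θ : AlgebraicClosure ℚ} (hθ : aeval θ (Cubic.toPoly ⟨1, ((-1 : ℤ) : ℚ), ((-11 : ℤ) : ℚ), ((-12 : ℤ) : ℚ)⟩) = 0) :
    haveI : FiniteDimensional ℚ (IntermediateField.adjoin ℚ {θ}) :=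
      IntermediateField.adjoin.finiteDimensional ((AlgebraicClosure.isAlgebraic ℚ).isAlgebraic θ).isIntegral
    haveI : NumberField (IntermediateField.adjoin ℚ {θ}) := NumberField.mk
    ∀ κL : ZpExtension (IntermediateField.adjoin ℚ {θ}) 2, κL.IsCyclotomic → ClassicalMuVanishes κL := by
  intro κL hκL
  have hθ' : θ ^ 3 + (-1 : AlgebraicClosure ℚ) * θ ^ 2 + (-11 : AlgebraicClosure ℚ) * θ + (-12 : AlgebraicClosure ℚ) = 0 := by
    have := hθ
    simp only [Cubic.toPoly, map_one, one_mul, aeval_add, aeval_mul, aeval_C, aeval_X_pow, aeval_X,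
      eq_ratCast, Rat.cast_intCast] at this
    push_cast at this
    linear_combination this
  have he : aeval (algebraMap ℚ (AlgebraicClosure ℚ) (((-79 : ℤ) : ℚ) / ((1 : ℤ) : ℚ)) +
      algebraMap ℚ (AlgebraicClosure ℚ) (((-91 : ℤ) : ℚ) / ((1 : ℤ) : ℚ)) * θ +
      algebraMap ℚ (AlgebraicClosure ℚ) (((-28 : ℤ) : ℚ) / ((1 : ℤ) : ℚ)) * θ ^ 2)
      (Cubic.toPoly ⟨1, ((972 : ℤ) : ℚ), ((54 : ℤ) : ℚ), ((1 : ℤ) : ℚ)⟩) = 0 := by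
    simp only [Cubic.toPoly, map_one, one_mul, aeval_add, aeval_mul, aeval_C, aeval_X_pow, aeval_X, eq_ratCast,
      Rat.cast_intCast, Rat.cast_div]
    push_cast
    linear_combination ((-464079 : AlgebraicClosure ℚ) + (-596820 : AlgebraicClosure ℚ) * θ + (-235984 : AlgebraicClosure ℚ) * θ ^ 2 + (-21952 : AlgebraicClosure ℚ) * θ ^ 3) * hθ'
  have hh := not_two_dvd_card_classGroup_adjoin_of_forall_cubicField_odd irreducible_cubic_d867n (odd_classNumber_of_root_d867n) hθ
  have h1 := layerOneBit_of_chevalleyCert irreducible_cubic_d867n hθ hh ⟨1, by norm_num⟩ ⟨0, by norm_num⟩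
      (-79) (-91) (-28) (1) (972) (54) (1) (by norm_num) he (4) (1) (by norm_num) (by norm_num) (by decide) (by decide)
  exact classicalMuVanishes_two_adjoin_of_odd_cubic_discr irreducible_cubic_d867n (by simp only [Cubic.discr]; norm_num) hθ hh κL hκL
    (h1 κL hκL)

/-! ### Row `152592cf1` (cubic field `d = -867`) -/

/-- The census cubic model of the C4″ row `152592cf1` (`y² = x³ + (-1)x² + (-21660383632)x + (-1227391922196032)`, addL2x GEN 13 `nst_census` a-invariants) is an elliptic curve. -/
theorem isElliptic_152592cf1' : (⟨0, ((-1 : ℤ) : ℚ), 0, ((-21660383632 : ℤ) : ℚ), ((-1227391922196032 : ℤ) : ℚ)⟩ : WeierstrassCurve ℚ).IsElliptic :=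
  isElliptic_cubicModel _ _ _ (by simp only [Cubic.discr]; norm_num)

/-- **UNCONDITIONAL (A)₂ for the C4″ census curve `152592cf1` — ZERO hypotheses, ZERO named facts** (additive potentially multiplicative at `2`,
irreducible `E[2]`, `Δ < 0`; `2`-torsion cubic field `ℚ(θ)`, `θ³ + (-1)θ² + (-11)θ + (-12) = 0`, `d = -867`, `p q, f(q)=2`, `h` odd). Coates–Sujatha's
statement (A) at `p = 2` for the cubic model `y² = x³ + (-1)x² + (-21660383632)x + (-1227391922196032)`: for every cyclotomic `ℤ₂`-extension of `ℚ` the dual fine Selmer group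
over `ℚ_∞` is finitely generated over `ℤ₂` (`∃ γ D` currency). KERNEL: `classicalMu_two_cubicField_d867n` above (μ₂(ℚ(θ)_cyc) = 0 for the field of `X³ + (-1)X² + (-11)X + (-12)`) ⟹ cruxlead-19573-w2's `ℓ = 2` ascent to the totally complex
`ℚ(E[2]) = ℚ(θ, √d)` and kernel Lim 3.5@2 (`TotallyComplexMu.conjA_two_cubicModel_of_classicalMu_of_discr_neg`); the root `β = x(T)` of the curve's cubic is
`-67603 + (22559)θ + (7837)θ²` and `ℚ(β) = ℚ(θ)`. This discharges the (I1M′) input of this row (GEN 9 `hAnaMI_negDisc_of_cubicFieldMu`) in the kernel;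
it is statement (A), NOT BSD: BSD₂ for `152592cf1` is NOT proved by this. [cite: CoatesSujatha2005, Conj. A and Thm. 3.4]
[cite: Iwasawa1973MuInvariants, Thm. 2 and Thm. 3] [cite: Fukuda1994, Thm. 1 (1), p. 264] [cite: Lang1990, Ch. 13 §4, Lemma 4.1] -/
theorem conjA_two_152592cf1' (κ : ZpExtension ℚ 2) (hκ : κ.IsCyclotomic) :
    haveI := isElliptic_152592cf1'
    ∃ (γ : absoluteGaloisGroup ℚ) (D : (⟨0, ((-1 : ℤ) : ℚ), 0, ((-21660383632 : ℤ) : ℚ), ((-1227391922196032 : ℤ) : ℚ)⟩ : WeierstrassCurve ℚ).FineSelmerDualData κ γ),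
      Module.Finite ℤ_[2] (RestrictScalars ℤ_[2] (IwasawaAlgebra 2) D.X) := by
  haveI := isElliptic_152592cf1'
  obtain ⟨θ, hθ⟩ : ∃ θ : AlgebraicClosure ℚ, aeval θ (Cubic.toPoly ⟨1, ((-1 : ℤ) : ℚ), ((-11 : ℤ) : ℚ), ((-12 : ℤ) : ℚ)⟩) = 0 :=
    IsAlgClosed.exists_aeval_eq_zero _ _ (by rw [Cubic.degree_of_a_ne_zero one_ne_zero]; norm_num)
  have hθ' : θ ^ 3 + (-1 : AlgebraicClosure ℚ) * θ ^ 2 + (-11 : AlgebraicClosure ℚ) * θ + (-12 : AlgebraicClosure ℚ) = 0 := by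
    have := hθ
    simp only [Cubic.toPoly, map_one, one_mul, aeval_add, aeval_mul, aeval_C, aeval_X_pow, aeval_X,
      eq_ratCast, Rat.cast_intCast] at this
    push_cast at this
    linear_combination this
  set β : AlgebraicClosure ℚ := algebraMap ℚ (AlgebraicClosure ℚ) (-67603 : ℚ) +
      algebraMap ℚ (AlgebraicClosure ℚ) (22559 : ℚ) * θ + algebraMap ℚ (AlgebraicClosure ℚ) (7837 : ℚ) * θ ^ 2 with hβdef
  have hβ : aeval β (Cubic.toPoly ⟨1, ((-1 : ℤ) : ℚ), ((-21660383632 : ℤ) : ℚ), ((-1227391922196032 : ℤ) : ℚ)⟩) = 0 := by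
    simp only [Cubic.toPoly, map_one, one_mul, aeval_add, aeval_mul, aeval_C, aeval_X_pow, aeval_X, eq_ratCast,
      Rat.cast_intCast]
    rw [hβdef]
    simp only [eq_ratCast]
    push_cast
    linear_combination ((6003873612731 : AlgebraicClosure ℚ) + (9441319715150 : AlgebraicClosure ℚ) * θ + (4637961819466 : AlgebraicClosure ℚ) * θ ^ 2 + (481337325253 : AlgebraicClosure ℚ) * θ ^ 3) * hθ'
  have hadj : IntermediateField.adjoin ℚ {β} = IntermediateField.adjoin ℚ {θ} := by
    apply le_antisymm
    · rw [IntermediateField.adjoin_simple_le_iff, hβdef]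
      have hθmem := IntermediateField.mem_adjoin_simple_self ℚ θ
      exact add_mem (add_mem (algebraMap_mem _ _) (mul_mem (algebraMap_mem _ _) hθmem))
        (mul_mem (algebraMap_mem _ _) (pow_mem hθmem 2))
    · rw [IntermediateField.adjoin_simple_le_iff]
      have hθeq : θ = algebraMap ℚ (AlgebraicClosure ℚ) (-818713817737/40213790496 : ℚ) +
          algebraMap ℚ (AlgebraicClosure ℚ) (-10586503/107236774656 : ℚ) * β +
          algebraMap ℚ (AlgebraicClosure ℚ) (461/321710323968 : ℚ) * β ^ 2 := by
        rw [hβdef]; simp only [eq_ratCast]; push_cast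
        linear_combination (((-662002915 : AlgebraicClosure ℚ) / 1113184512) + ((-97972181 : AlgebraicClosure ℚ) / 1113184512) * θ) * hθ'
      rw [hθeq]
      have hβmem := IntermediateField.mem_adjoin_simple_self ℚ β
      exact add_mem (add_mem (algebraMap_mem _ _) (mul_mem (algebraMap_mem _ _) hβmem))
        (mul_mem (algebraMap_mem _ _) (pow_mem hβmem 2))
  have h3 : Module.finrank ℚ (IntermediateField.adjoin ℚ {β}) = 3 := by
    rw [hadj]; exact finrank_adjoin_eq_three_of_irreducible irreducible_cubic_d867n hθ
  exact TotallyComplexMu.conjA_two_cubicModel_of_classicalMu_of_discr_neg (-1) (-21660383632) (-1227391922196032)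
    (irreducible_cubic_of_finrank_adjoin_eq_three hβ h3) (by simp only [Cubic.discr]; norm_num) hβ
    (by rw [hadj]; exact classicalMu_two_cubicField_d867n hθ) κ hκ

/-! ## The cubic field of discriminant `-948` (`X³ + (-1)X² + (0)X + (6)`, index `1`; C4″ rows 379200cd1) -/

/-- `X³ + (-1)X² + (0)X + (6)` is irreducible over `ℚ` (no root mod `7`). -/
theorem irreducible_cubic_d948n : Irreducible (Cubic.toPoly ⟨1, ((-1 : ℤ) : ℚ), ((0 : ℤ) : ℚ), ((6 : ℤ) : ℚ)⟩) :=
  haveI : Fact (Nat.Prime 7) := ⟨by norm_num⟩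
  irreducible_cubic_of_no_root_zmod 7 (by decide)

section Certd948n

variable (K : Type) [Field K] [NumberField K]

/-- **`h` is ODD for every cubic number field whose integers contain a root `θ` of `X³ + (-1)X² + (0)X + (6)`** (`|disc| = 948` = `|d_K|`,
`M_K < 9`): a norm certificate — for every prime `ℓ < 9` and every root `a` of the cubic mod `ℓ` a generator `x + yθ + zθ² ∈ ℤ[θ]` of norm `±ℓ`
of the ideal `I ∋ ℓ, θ − a` (coordinates `(x, y, z)`: `ℓ = 2`: `a = 0` ↦ `(8, -5, 2)`, `a = 1` ↦ `(-11, -1, 4)`; `ℓ = 3`: `a = 0` ↦ `(-3, -2, 0)`, `a = 1` ↦ `(-7, -3, 1)`; `ℓ = 5`: `a = 2` ↦ `(1, -1, -1)`; `ℓ = 7`: no root); found by the seat's relation sieve and CHECKED HERE by the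
kernel (`pow_three_eq_span_of_cert`, `Or.inl`). eng-2's PARI value (bnfcertify): `h = 1`. KERNEL. [cite: Marcus1977, Ch. 5 Thm. 35–37 and Cor. 2] [cite: Cohen1993, §6.3] -/
theorem odd_classNumber_of_root_d948n (h3 : Module.finrank ℚ K = 3) (b : 𝓞 K)
    (hb : b ^ 3 + (-1 : ℤ) * b ^ 2 + (0 : ℤ) * b + (6 : ℤ) = 0) : Odd (NumberField.classNumber K) := by
  have hirr := irreducible_cubic_d948n
  have hd : |NumberField.discr K| ≤ (948 : ℕ) :=
    (abs_discr_le_abs_cubic_discr K h3 b hirr hb).trans (by simp only [Cubic.discr]; norm_num)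
  refine odd_classNumber_of_cubeCertificate K h3 (B := 9)
    (minkowskiBound_lt_of_sqrt_le K h3 hd (s := 30.79)
      ((Real.sqrt_le_sqrt (by norm_num : ((948 : ℕ) : ℝ) ≤ (30.79 : ℝ) ^ 2)).trans (Real.sqrt_sq (by norm_num)).le)
      (by norm_num)) ?_
  intro ℓ hℓB hℓ J hJ
  interval_cases ℓ <;> norm_num at hℓ
  · -- `ℓ = 2`: roots [0, 1]
    refine pow_three_eq_span_of_cert K h3 b hirr hb (by norm_num) (fun a ha hdvd => ?_) hJ
    interval_cases a <;> norm_num at hdvd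
    · exact Or.inl ⟨(8), (-5), (2), 1, by norm_num, by norm_num, ⟨_, by rw [Nat.cast_one, one_mul]⟩, by norm_num⟩
    · exact Or.inl ⟨(-11), (-1), (4), 1, by norm_num, by norm_num, ⟨_, by rw [Nat.cast_one, one_mul]⟩, by norm_num⟩
  · -- `ℓ = 3`: roots [0, 1]
    refine pow_three_eq_span_of_cert K h3 b hirr hb (by norm_num) (fun a ha hdvd => ?_) hJ
    interval_cases a <;> norm_num at hdvd
    · exact Or.inl ⟨(-3), (-2), (0), 1, by norm_num, by norm_num, ⟨_, by rw [Nat.cast_one, one_mul]⟩, by norm_num⟩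
    · exact Or.inl ⟨(-7), (-3), (1), 1, by norm_num, by norm_num, ⟨_, by rw [Nat.cast_one, one_mul]⟩, by norm_num⟩
  · -- `ℓ = 5`: roots [2]
    refine pow_three_eq_span_of_cert K h3 b hirr hb (by norm_num) (fun a ha hdvd => ?_) hJ
    interval_cases a <;> norm_num at hdvd
    · exact Or.inl ⟨(1), (-1), (-1), 1, by norm_num, by norm_num, ⟨_, by rw [Nat.cast_one, one_mul]⟩, by norm_num⟩
  · -- `ℓ = 7`: roots []
    refine pow_three_eq_span_of_cert K h3 b hirr hb (by norm_num) (fun a ha hdvd => ?_) hJ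
    interval_cases a <;> norm_num at hdvd

end Certd948n

/-- **Iwasawa's `μ₂ = 0` for the cubic field of discriminant `-948`** (`ℚ(θ)`, `θ³ + (-1)θ² + (0)θ + (6) = 0`; TWO primes above `2`,
`2 = 𝔭𝔮²`; `h` odd), KERNEL — every cyclotomic `ℤ₂`-extension of `ℚ(θ)` has `μ = 0` (growth form; indeed `e_n = 0` for all `n`).
Chevalley's door at `2` (k4-w1 `layerOneBit_of_chevalleyCert`): the unit `ε = (-8963) + (5829)θ + (-2297)θ²` (regulator ≈ 10.06;
`ε³ + (23357)ε² + (149)ε + (1) = 0`) has `ε ≡ 3 (mod 8)` under `θ ↦ z₂ ≡ 3` (`8 ∣ g(3)`, `g'(3)` odd), so `(ε, 2)_𝔭 = −1`: a non-norm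
from `ℚ(θ, √2)`, whence `e₁ = 0`; `≤ 2` primes above `2` by `4 ∤ g(0)`, `4 ∤ g(1)`; `e₀ = 0` by `odd_classNumber_of_root_d948n`; `n₀ = 0` by an even-index certificate `u, v, m, m'` (`u² − 2v² = 4m`, `m² = 2m'`, `8 ∤ N(2 − m'³)`; `classicalMuVanishes_two_adjoin_of_evenIndexCertificate`); Fukuda 1994 Thm. 1 (1) (`_holds`).
The (I1M′) input of GEN 9's door for the C4″ rows 379200cd1. [cite: Fukuda1994, Thm. 1 (1), p. 264] [cite: Lang1990, Ch. 13 §4, Lemma 4.1]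
[cite: Washington1997, §13.1] [cite: Greenberg2001IwasawaPastPresent, §4 (Iwasawa's μ-conjecture)] -/
theorem classicalMu_two_cubicField_d948n {θ : AlgebraicClosure ℚ} (hθ : aeval θ (Cubic.toPoly ⟨1, ((-1 : ℤ) : ℚ), ((0 : ℤ) : ℚ), ((6 : ℤ) : ℚ)⟩) = 0) :
    haveI : FiniteDimensional ℚ (IntermediateField.adjoin ℚ {θ}) :=
      IntermediateField.adjoin.finiteDimensional ((AlgebraicClosure.isAlgebraic ℚ).isAlgebraic θ).isIntegral
    haveI : NumberField (IntermediateField.adjoin ℚ {θ}) := NumberField.mk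
    ∀ κL : ZpExtension (IntermediateField.adjoin ℚ {θ}) 2, κL.IsCyclotomic → ClassicalMuVanishes κL := by
  intro κL hκL
  have hθ' : θ ^ 3 + (-1 : AlgebraicClosure ℚ) * θ ^ 2 + (0 : AlgebraicClosure ℚ) * θ + (6 : AlgebraicClosure ℚ) = 0 := by
    have := hθ
    simp only [Cubic.toPoly, map_one, one_mul, aeval_add, aeval_mul, aeval_C, aeval_X_pow, aeval_X,
      eq_ratCast, Rat.cast_intCast] at this
    push_cast at this
    linear_combination this
  have he : aeval (algebraMap ℚ (AlgebraicClosure ℚ) (((-8963 : ℤ) : ℚ) / ((1 : ℤ) : ℚ)) +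
      algebraMap ℚ (AlgebraicClosure ℚ) (((5829 : ℤ) : ℚ) / ((1 : ℤ) : ℚ)) * θ +
      algebraMap ℚ (AlgebraicClosure ℚ) (((-2297 : ℤ) : ℚ) / ((1 : ℤ) : ℚ)) * θ ^ 2)
      (Cubic.toPoly ⟨1, ((23357 : ℤ) : ℚ), ((149 : ℤ) : ℚ), ((1 : ℤ) : ℚ)⟩) = 0 := by
    simp only [Cubic.toPoly, map_one, one_mul, aeval_add, aeval_mul, aeval_C, aeval_X_pow, aeval_X, eq_ratCast,
      Rat.cast_intCast, Rat.cast_div]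
    push_cast
    linear_combination ((192724327650 : AlgebraicClosure ℚ) + (-172627123209 : AlgebraicClosure ℚ) * θ + (80145614710 : AlgebraicClosure ℚ) * θ ^ 2 + (-12119452073 : AlgebraicClosure ℚ) * θ ^ 3) * hθ'
  have hh := not_two_dvd_card_classGroup_adjoin_of_forall_cubicField_odd irreducible_cubic_d948n (odd_classNumber_of_root_d948n) hθ
  have h1 := layerOneBit_of_chevalleyCert irreducible_cubic_d948n hθ hh ⟨0, by norm_num⟩ ⟨0, by norm_num⟩
      (-8963) (5829) (-2297) (1) (23357) (149) (1) (by norm_num) he (3) (1) (by norm_num) (by norm_num) (by decide) (by decide)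
  have hirr := irreducible_cubic_d948n
  haveI : FiniteDimensional ℚ (IntermediateField.adjoin ℚ {θ}) :=
    IntermediateField.adjoin.finiteDimensional ((AlgebraicClosure.isAlgebraic ℚ).isAlgebraic θ).isIntegral
  haveI : NumberField (IntermediateField.adjoin ℚ {θ}) := NumberField.mk
  obtain ⟨B, -, hB⟩ := exists_ringOfIntegers_cubic_root (p := -1) (q := 0) (r := 6) hθ
  have h3 := finrank_adjoin_eq_three_of_irreducible hirr hθ
  refine classicalMuVanishes_two_adjoin_of_evenIndexCertificate (p := -1) (q := 0) (r := 6) hirr hθ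
    (((-2 : ℤ) : 𝓞 (IntermediateField.adjoin ℚ {θ})) + ((-2 : ℤ) : 𝓞 (IntermediateField.adjoin ℚ {θ})) * B + ((0 : ℤ) : 𝓞 (IntermediateField.adjoin ℚ {θ})) * B ^ 2) (((0 : ℤ) : 𝓞 (IntermediateField.adjoin ℚ {θ})) + ((-1 : ℤ) : 𝓞 (IntermediateField.adjoin ℚ {θ})) * B + ((-1 : ℤ) : 𝓞 (IntermediateField.adjoin ℚ {θ})) * B ^ 2) (((10 : ℤ) : 𝓞 (IntermediateField.adjoin ℚ {θ})) + ((5 : ℤ) : 𝓞 (IntermediateField.adjoin ℚ {θ})) * B + ((-1 : ℤ) : 𝓞 (IntermediateField.adjoin ℚ {θ})) * B ^ 2) (((77 : ℤ) : 𝓞 (IntermediateField.adjoin ℚ {θ})) + ((47 : ℤ) : 𝓞 (IntermediateField.adjoin ℚ {θ})) * B + ((-2 : ℤ) : 𝓞 (IntermediateField.adjoin ℚ {θ})) * B ^ 2) ?_ ?_ ?_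
    hh κL hκL (h1 κL hκL)
  · push_cast; linear_combination (((-6 : ℤ) : 𝓞 (IntermediateField.adjoin ℚ {θ})) + ((-2 : ℤ) : 𝓞 (IntermediateField.adjoin ℚ {θ})) * B + ((0 : ℤ) : 𝓞 (IntermediateField.adjoin ℚ {θ})) * B ^ 2) * hB
  · push_cast; linear_combination (((-9 : ℤ) : 𝓞 (IntermediateField.adjoin ℚ {θ})) + ((1 : ℤ) : 𝓞 (IntermediateField.adjoin ℚ {θ})) * B + ((0 : ℤ) : 𝓞 (IntermediateField.adjoin ℚ {θ})) * B ^ 2) * hB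
  · have hz : (2 : 𝓞 (IntermediateField.adjoin ℚ {θ})) - (((77 : ℤ) : 𝓞 (IntermediateField.adjoin ℚ {θ})) + ((47 : ℤ) : 𝓞 (IntermediateField.adjoin ℚ {θ})) * B + ((-2 : ℤ) : 𝓞 (IntermediateField.adjoin ℚ {θ})) * B ^ 2) ^ 3 =
        ((-164517 : ℤ) : 𝓞 (IntermediateField.adjoin ℚ {θ})) + (-906633 : ℤ) * B + (-520038 : ℤ) * B ^ 2 := by
      push_cast; linear_combination (((-48669 : ℤ) : 𝓞 (IntermediateField.adjoin ℚ {θ})) + ((11774 : ℤ) : 𝓞 (IntermediateField.adjoin ℚ {θ})) * B + ((-556 : ℤ) : 𝓞 (IntermediateField.adjoin ℚ {θ})) * B ^ 2 + ((8 : ℤ) : 𝓞 (IntermediateField.adjoin ℚ {θ})) * B ^ 3 + ((0 : ℤ) : 𝓞 (IntermediateField.adjoin ℚ {θ})) * B ^ 4) * hB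
    rw [hz]
    exact not_eight_dvd_norm_coords _ h3 B hirr hB (-164517) (-906633) (-520038) (N := 24565207788090)
      (by simp only [Matrix.one_fin_three, Matrix.det_fin_three, Matrix.add_apply, Matrix.smul_apply, sq, Matrix.mul_apply,
        Fin.sum_univ_three, Matrix.of_apply, Matrix.cons_val', Matrix.cons_val_zero, Matrix.cons_val_one, Matrix.cons_val_two,
        Matrix.head_cons, Matrix.tail_cons, Matrix.empty_val', Matrix.cons_val_fin_one, smul_eq_mul]; norm_num) (by norm_num)

/-! ### Row `379200cd1` (cubic field `d = -948`) -/

/-- The census cubic model of the C4″ row `379200cd1` (`y² = x³ + (-1)x² + (-30775636033)x + (5971535432691937)`, addL2x GEN 13 `nst_census` a-invariants) is an elliptic curve. -/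
theorem isElliptic_379200cd1' : (⟨0, ((-1 : ℤ) : ℚ), 0, ((-30775636033 : ℤ) : ℚ), ((5971535432691937 : ℤ) : ℚ)⟩ : WeierstrassCurve ℚ).IsElliptic :=
  isElliptic_cubicModel _ _ _ (by simp only [Cubic.discr]; norm_num)

/-- **UNCONDITIONAL (A)₂ for the C4″ census curve `379200cd1` — ZERO hypotheses, ZERO named facts** (additive potentially multiplicative at `2`,
irreducible `E[2]`, `Δ < 0`; `2`-torsion cubic field `ℚ(θ)`, `θ³ + (-1)θ² + (0)θ + (6) = 0`, `d = -948`, `p q^2, F_q=Q2(sqrt3)`, `h` odd). Coates–Sujatha's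
statement (A) at `p = 2` for the cubic model `y² = x³ + (-1)x² + (-30775636033)x + (5971535432691937)`: for every cyclotomic `ℤ₂`-extension of `ℚ` the dual fine Selmer group
over `ℚ_∞` is finitely generated over `ℤ₂` (`∃ γ D` currency). KERNEL: `classicalMu_two_cubicField_d948n` above (μ₂(ℚ(θ)_cyc) = 0 for the field of `X³ + (-1)X² + (0)X + (6)`) ⟹ cruxlead-19573-w2's `ℓ = 2` ascent to the totally complex
`ℚ(E[2]) = ℚ(θ, √d)` and kernel Lim 3.5@2 (`TotallyComplexMu.conjA_two_cubicModel_of_classicalMu_of_discr_neg`); the root `β = x(T)` of the curve's cubic is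
`-4463 + (67620)θ + (-54230)θ²` and `ℚ(β) = ℚ(θ)`. This discharges the (I1M′) input of this row (GEN 9 `hAnaMI_negDisc_of_cubicFieldMu`) in the kernel;
it is statement (A), NOT BSD: BSD₂ for `379200cd1` is NOT proved by this. [cite: CoatesSujatha2005, Conj. A and Thm. 3.4]
[cite: Iwasawa1973MuInvariants, Thm. 2 and Thm. 3] [cite: Fukuda1994, Thm. 1 (1), p. 264] [cite: Lang1990, Ch. 13 §4, Lemma 4.1] -/
theorem conjA_two_379200cd1' (κ : ZpExtension ℚ 2) (hκ : κ.IsCyclotomic) :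
    haveI := isElliptic_379200cd1'
    ∃ (γ : absoluteGaloisGroup ℚ) (D : (⟨0, ((-1 : ℤ) : ℚ), 0, ((-30775636033 : ℤ) : ℚ), ((5971535432691937 : ℤ) : ℚ)⟩ : WeierstrassCurve ℚ).FineSelmerDualData κ γ),
      Module.Finite ℤ_[2] (RestrictScalars ℤ_[2] (IwasawaAlgebra 2) D.X) := by
  haveI := isElliptic_379200cd1'
  obtain ⟨θ, hθ⟩ : ∃ θ : AlgebraicClosure ℚ, aeval θ (Cubic.toPoly ⟨1, ((-1 : ℤ) : ℚ), ((0 : ℤ) : ℚ), ((6 : ℤ) : ℚ)⟩) = 0 :=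
    IsAlgClosed.exists_aeval_eq_zero _ _ (by rw [Cubic.degree_of_a_ne_zero one_ne_zero]; norm_num)
  have hθ' : θ ^ 3 + (-1 : AlgebraicClosure ℚ) * θ ^ 2 + (0 : AlgebraicClosure ℚ) * θ + (6 : AlgebraicClosure ℚ) = 0 := by
    have := hθ
    simp only [Cubic.toPoly, map_one, one_mul, aeval_add, aeval_mul, aeval_C, aeval_X_pow, aeval_X,
      eq_ratCast, Rat.cast_intCast] at this
    push_cast at this
    linear_combination this
  set β : AlgebraicClosure ℚ := algebraMap ℚ (AlgebraicClosure ℚ) (-4463 : ℚ) +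
      algebraMap ℚ (AlgebraicClosure ℚ) (67620 : ℚ) * θ + algebraMap ℚ (AlgebraicClosure ℚ) (-54230 : ℚ) * θ ^ 2 with hβdef
  have hβ : aeval β (Cubic.toPoly ⟨1, ((-1 : ℤ) : ℚ), ((-30775636033 : ℤ) : ℚ), ((5971535432691937 : ℤ) : ℚ)⟩) = 0 := by
    simp only [Cubic.toPoly, map_one, one_mul, aeval_add, aeval_mul, aeval_C, aeval_X_pow, aeval_X, eq_ratCast,
      Rat.cast_intCast]
    rw [hβdef]
    simp only [eq_ratCast]
    push_cast
    linear_combination ((1018133030118000 : AlgebraicClosure ℚ) + (-346167877440000 : AlgebraicClosure ℚ) * θ + (437104911727000 : AlgebraicClosure ℚ) * θ ^ 2 + (-159484621967000 : AlgebraicClosure ℚ) * θ ^ 3) * hθ'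
  have hadj : IntermediateField.adjoin ℚ {β} = IntermediateField.adjoin ℚ {θ} := by
    apply le_antisymm
    · rw [IntermediateField.adjoin_simple_le_iff, hβdef]
      have hθmem := IntermediateField.mem_adjoin_simple_self ℚ θ
      exact add_mem (add_mem (algebraMap_mem _ _) (mul_mem (algebraMap_mem _ _) hθmem))
        (mul_mem (algebraMap_mem _ _) (pow_mem hθmem 2))
    · rw [IntermediateField.adjoin_simple_le_iff]
      have hθeq : θ = algebraMap ℚ (AlgebraicClosure ℚ) (142757004918083/94478400000000 : ℚ) +
          algebraMap ℚ (AlgebraicClosure ℚ) (-5527909/7873200000000 : ℚ) * β +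
          algebraMap ℚ (AlgebraicClosure ℚ) (-5423/94478400000000 : ℚ) * β ^ 2 := by
        rw [hβdef]; simp only [eq_ratCast]; push_cast
        linear_combination (((-238241733829 : AlgebraicClosure ℚ) / 944784000000) + ((159484621967 : AlgebraicClosure ℚ) / 944784000000) * θ) * hθ'
      rw [hθeq]
      have hβmem := IntermediateField.mem_adjoin_simple_self ℚ β
      exact add_mem (add_mem (algebraMap_mem _ _) (mul_mem (algebraMap_mem _ _) hβmem))
        (mul_mem (algebraMap_mem _ _) (pow_mem hβmem 2))
  have h3 : Module.finrank ℚ (IntermediateField.adjoin ℚ {β}) = 3 := by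
    rw [hadj]; exact finrank_adjoin_eq_three_of_irreducible irreducible_cubic_d948n hθ
  exact TotallyComplexMu.conjA_two_cubicModel_of_classicalMu_of_discr_neg (-1) (-30775636033) (5971535432691937)
    (irreducible_cubic_of_finrank_adjoin_eq_three hβ h3) (by simp only [Cubic.discr]; norm_num) hβ
    (by rw [hadj]; exact classicalMu_two_cubicField_d948n hθ) κ hκ
end Summit.BirchSwinnertonDyer.BirchSwinnertonDyer.Theorems.AddKatoTwo

end
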